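import Summits.QuantumFields.YangMills.Theorems.BalabanUVNodesN22W1StripGenerator

/-!
# BalabanUVNodes ∕ node N22 = NE9 — THE STRIP INDUCTION AT THE W1 OBJECT, MODULE 18′: THE LAST COUPLING IN PRINT's CONDITIONAL SHAPE — «(1.18) for the old terms at
# the real history ⟹ the new term holomorphic in its last coupling with (1.18) on a complex neighbourhood» ([I] p. 263's inductive clause) — FED BY THE INDUCTION
# ITSELF, and its generator-level face (S-last); node N09's unconditional `EHoloAt` family is no longer an input

Cell `pub-ymgap`, HUMAN RULING D-0062 (Track A), R134 ACCELERATION re-seat `pub-ymgap-dag-n22-c` (strategy s1), generation 4, module 18′.  THEOREMS ONLY; imports module 16′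
`…N22W1StripGenerator` (transitively 14′ ∕ 15′, node00-def-W1 g4's `HistoryRecursionOfRecord`) BY NAME.  `--supports` K3′ (helper).

WHY.  Modules 11 ∕ 14′ ∕ 15′ ∕ 16′ take node N09's currency as an UNCONDITIONAL family `∀ g ∈ ]0,γ]^ℕ, ∀ k′, ∃ H : EHoloAt …` — but in print ([I] p. 263, [B12] Thm 3) the
holomorphy of the new term `E^{(k′+1)}` in its last coupling `g_{k′}` with (1.18) on a complex neighbourhood is proved UNDER the inductive assumptions (1.18) for the old
terms `E^{(j)}`, `j ≤ k′`, at the real history — assumptions the strip induction itself produces on the way up.  This module types the last-coupling input in that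
CONDITIONAL shape (`hlastOn`) and feeds its premise from the induction hypothesis (the fixed-domain STRIP of the lower terms, read at the window point `g_{k′} ∈ D`), so the
N09-side input of the chain is exactly print's inductive clause; on a generated tower it is the per-step generator schema (S-last): «for every older-terms family there is
an open `U ⊇` the closed `r`-discs about `]0,γ]` on which, IF the family is (1.18)-bounded on the space tables, `t ↦ (Gn k′).E t old φ X` is holomorphic with
`‖·‖ ≤ E₀e^{−κ d_{k′+1}(X)}`».

WHAT.
* §1 ★ `stripBound_termC_of_termwise226OnOlder_lastOn` — THE SELF-FEEDING MIXED PRODUCER: `h226TOnOlder` (universal domain; N10's lane) + `hlastOn` (conditional, per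
  history and step; N09's lane in print's shape) + `0 ≤ r` + socket numerals + S25 + renewal ⟹ module 1's ∃O-STRIP at every level in every coupling at the spaces of record
  (module 14′ §1's induction with `D g i := U g i`, the domain of `hlastOn` at `(g, i)`; older couplings by 14′ §2, the last coupling by `hlastOn` whose premise is the step's
  own inductive premise read at `t := g_i`).
* §2 `lastOn_truncRun` — `hlastOn` for `truncRun K T` at every level ⇐ the same for `T` at the levels `k′ < K` (beyond the run: `U := ℂ`, `Ec := 0`);
  ★ `lastOn_toClusterTower_of_stepSchemaLast` — (S-last)_{k′<K} on a generator tower `Gn` ⟹ `hlastOn` for `toClusterTower Gn` at the levels `k′ < K` (`recTerm_succ`,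
  `recTerm_congr_prefix`, `termC_toClusterTower`: the older terms do not read `g_{k′}`).
* §3 `lastOn_termlessTower`, `stepGenE_termlessGen`, `stepSchemaLast_termlessGen` — NON-VACUITY (A5 riders; the termless generator's one-step map is `0`).

HONEST FRAMING.  Count-neutral by-name knit AT THE OBJECT; NOT a discharge of N22.  `hlastOn` ∕ (S-last) are DISPLAYED, asserted nowhere — they are [I] p. 263's clause
«E^{(j)}(X, g, φ) … is a C^∞-function of g_{j−1} ∈ [0, γ] (or analytic)» with (1.18) on a complex neighbourhood, CONDITIONAL on (1.18) for the older terms (node N09's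
content: [B12] Thm 3 ∕ [H-dil]); (1.19) and the configuration-analyticity half of (1.18) are not tracked by this currency and stay inside the supplier's proof.  NE9 NOT IN
PRINT; one finite four-torus programme at fixed ε — NOT infinite volume, NOT OS on ℝ⁴, NOT a mass gap, NOT Clay.  0 `sorry`, 0 `def`, standard axioms.

References (TYPES only): [I] = [Balaban1987RG1] (0.23)–(0.24) pp. 256–257, §1 p. 263 (the inductive assumptions and the clause before (1.18)), pp. 266–267, (2.12)–(2.13)
p. 268; [II] = [Balaban1988RG2Cluster] (2.13)–(2.15) pp. 14–15, (2.26) p. 17, (2.40)–(2.41) p. 21.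
-/

noncomputable section

open scoped Matrix.Norms.L2Operator

namespace YMDAG.N22.W1

open Set Metric
open scoped BigOperators
open Literature.MathematicalPhysics.QuantumFieldTheory.Balaban1983to89
open Literature.MathematicalPhysics.QuantumFieldTheory.Balaban1983to89.T4Continuum
open Literature.MathematicalPhysics.QuantumFieldTheory.Balaban1983to89.T4OutputRate
open Literature.MathematicalPhysics.QuantumFieldTheory.Balaban1983to89.TreeLengthTorus (TPt TDom tsys torusTreeLen torusTreeLen_nonneg)
open Literature.MathematicalPhysics.QuantumFieldTheory.Balaban1983to89.B12TreeDecay (K₀ K₀_pos)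
open Literature.MathematicalPhysics.QuantumFieldTheory.Balaban1983to89.B13Lemma3TorusData (TBond)
open Literature.MathematicalPhysics.QuantumFieldTheory.Balaban1983to89.B13Lemma3TorusTerms (terms weight weight_nonneg)
open Literature.MathematicalPhysics.QuantumFieldTheory.Balaban1983to89.B13Lemma3TorusSocket (Lemma3Numerics)
open Literature.MathematicalPhysics.QuantumFieldTheory.Balaban1983to89.Step (SFConsts)
open Literature.MathematicalPhysics.QuantumFieldTheory.Balaban1983to89.Node00
  (Stage12Params IsDatumOfRecord₁₂C U3Objects₁₁ U3Letters₁₁ MatA ιSU prependCoupling)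
open Literature.MathematicalPhysics.QuantumFieldTheory.Balaban1983to89.Node00.Sect2 (domSys domCount CPair ofBackgroundC spaceI domSites Setting Residual)
open Literature.MathematicalPhysics.QuantumFieldTheory.Balaban1983to89.Node00.W1
open YMDAG.UVSplit

variable {N : ℕ} [NeZero N]

/-! ## §1 The self-feeding mixed producer: older couplings by `h226TOnOlder`, the last coupling by print's conditional clause -/

section Producer

variable (F : T4Family) (K : ℕ) {𝔸 : Type*} [NormedRing 𝔸] [NormedAlgebra ℂ 𝔸] [CompleteSpace 𝔸] {G : Type*} [GaugeGroup G] {M : ℕ}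
  (Sg : Setting 𝔸 G) (Rz : Residual (F.P K) 𝔸)

open Classical in
/-- **STRIP AT EVERY LEVEL IN EVERY COUPLING FROM THE OLDER-COUPLING LEVEL-T HYPOTHESIS (UNIVERSAL DOMAIN) + THE LAST COUPLING IN PRINT's CONDITIONAL SHAPE.**
`hlastOn` (node N09's lane, DISPLAYED): for every window history `g` and step `k` there is an open `U ⊇` the closed `r`-discs about `]0, γ]` such that IF the lower terms
`E^{(j)}(Y, ψ; g)`, `j ≤ k`, `ψ ∈ U^c_j(Y)`, obey (1.18) `‖·‖ ≤ E₀e^{−κ d_j(Y)}` AT THE REAL HISTORY `g` ([I] p. 263's inductive assumptions), THEN for every `X ∈ 𝐃_{k+1}`,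
`φ ∈ U^c_{k+1}(X)` the new term `t ↦ E^{(k+1)}(X; g|g_k := t; φ)` extends holomorphically to `U` with (1.18) there.  With `h226TOnOlder` (module 14′ §4's, node N10's lane),
`0 ≤ r`, the socket numerals, S25 and the renewal: module 1's ∃O-STRIP everywhere.  Proof: module 14′ §1's induction on the domain family `D g i := U(g, i)`; an older coupling
by `h226TOnOlder` at that domain + 14′ §2; the last coupling by `hlastOn`, whose premise IS the step's inductive premise read at the window point `t := g_k ∈ D g k`.
[cite: Balaban1987RG1, §1 p.263 (inductive assumptions (1.18) and the clause before it) and pp.266-267; Balaban1988RG2Cluster, (2.14)-(2.26) pp.15-17 and (2.40)-(2.41) p.21] -/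
theorem stripBound_termC_of_termwise226OnOlder_lastOn [NeZero M] (S : ClusterTower (F.P K) 𝔸 M) (c : B13.Consts) {L : ℕ} [NeZero L]
    (hL : 8 ≤ c.L) (hLc : c.L = L) {a a₂ a₂' a₅ Aabs : ℝ} (hN : Lemma3Numerics c M ((c.L : ℝ) / 2) a a₂ a₂' a₅ Aabs)
    {cs : SFConsts} {γ r E₀ κ r₁ : ℝ} (hr : 0 ≤ r) (hA0 : 0 ≤ c.C3act * c.ε₁) (hr₁ : 0 ≤ r₁) (hκ : κ ≤ r₁)
    (hrate : r₁ + 2 * (64 * Real.log 162) + 2 ≤ (1 - 8 * c.δ) * ((c.L : ℝ) / 2) * c.κ)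
    (hsmall : c.C3act * c.ε₁ * Real.exp (5 * r₁ + 1) * K₀ 64 8 * 9 * 64 ≤ 1)
    (hrenew : Real.exp 1 * 9 * 64 * K₀ 64 8 ^ 2 * (c.C3act * c.ε₁) ≤ E₀)
    (h226TOnOlder : ∀ (D : Set ℂ), IsOpen D → (∀ t ∈ Ioc (0 : ℝ) γ, closedBall (t : ℂ) r ⊆ D) →
      ∀ (k : ℕ) (g : ℕ → ℝ), g ∈ Window γ → ∀ (i : ℕ), i < k → ∀ (X : (domSys (F.P K) M (k + 1)).Dom) (φ : CPair (F.P K) 𝔸),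
      φ ∈ spaceI Sg Rz M (k + 1) (domSites (F.P K) M (k + 1) X) cs.α₀ cs.α₁ →
      (∀ (j : ℕ), j < k + 1 → ∀ (Y : (domSys (F.P K) M j).Dom) (ψ : CPair (F.P K) 𝔸), ψ ∈ spaceI Sg Rz M j (domSites (F.P K) M j Y) cs.α₀ cs.α₁ →
        ∃ Ec : ℂ → ℂ, DifferentiableOn ℂ Ec D ∧ (∀ z ∈ D, ‖Ec z‖ ≤ E₀ * Real.exp (-(κ * torusTreeLen Y.1))) ∧
          (∀ t ∈ Ioc (0 : ℝ) γ, Ec t = termC S j Y (Function.update g i t) ψ)) →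
      ∃ (Hc : ℂ → TDom 4 (domCount (F.P K) M (k + 1)) → ℂ)
        (Tt : (Z : TDom 4 (domCount (F.P K) M (k + 1))) →
          Finset (TDom 4 (L * domCount (F.P K) M (k + 1))) × Finset (TBond 4 M (L * domCount (F.P K) M (k + 1))) → ℂ → ℂ),
        (∀ Z : (domSys (F.P K) M (k + 1)).Dom, Z.1 ⊆ X.1 → DifferentiableOn ℂ (fun z => Hc z Z) D) ∧
        (∀ z ∈ D, ∀ Z : TDom 4 (domCount (F.P K) M (k + 1)), Z.1 ⊆ X.1 → ‖Hc z Z‖ ≤ ∑ t ∈ terms L M Z, ‖Tt Z t z‖) ∧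
        (∀ z ∈ D, ∀ Z : TDom 4 (domCount (F.P K) M (k + 1)), Z.1 ⊆ X.1 → ∀ t ∈ terms L M Z,
          ‖Tt Z t z‖ ≤ weight L M c Z a t * Real.exp (a₅ * ((Z.1).card : ℝ))) ∧
        (∀ t ∈ Ioc (0 : ℝ) γ, Hc t = (S k).H (restrictPrefix k (Function.update g i t)) φ))
    (hlastOn : ∀ (g : ℕ → ℝ), g ∈ Window γ → ∀ (k : ℕ), ∃ U : Set ℂ, IsOpen U ∧ (∀ t ∈ Ioc (0 : ℝ) γ, closedBall (t : ℂ) r ⊆ U) ∧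
      ((∀ (j : ℕ), j < k + 1 → ∀ (Y : (domSys (F.P K) M j).Dom) (ψ : CPair (F.P K) 𝔸), ψ ∈ spaceI Sg Rz M j (domSites (F.P K) M j Y) cs.α₀ cs.α₁ →
          ‖termC S j Y g ψ‖ ≤ E₀ * Real.exp (-(κ * torusTreeLen Y.1))) →
        ∀ (X : (domSys (F.P K) M (k + 1)).Dom) (φ : CPair (F.P K) 𝔸), φ ∈ spaceI Sg Rz M (k + 1) (domSites (F.P K) M (k + 1) X) cs.α₀ cs.α₁ →
          ∃ Ec : ℂ → ℂ, DifferentiableOn ℂ Ec U ∧ (∀ z ∈ U, ‖Ec z‖ ≤ E₀ * Real.exp (-(κ * torusTreeLen X.1))) ∧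
            (∀ t ∈ Ioc (0 : ℝ) γ, Ec t = termC S (k + 1) X (Function.update g k t) φ))) :
    ∀ (j : ℕ) (g : ℕ → ℝ), g ∈ Window γ → ∀ (i : ℕ) (Y : (domSys (F.P K) M j).Dom) (ψ : CPair (F.P K) 𝔸),
      ψ ∈ spaceI Sg Rz M j (domSites (F.P K) M j Y) cs.α₀ cs.α₁ →
      ∃ (Ec : ℂ → ℂ) (O : Set ℂ), IsOpen O ∧ (∀ t ∈ Ioc (0 : ℝ) γ, closedBall (t : ℂ) r ⊆ O) ∧ DifferentiableOn ℂ Ec O ∧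
        (∀ z ∈ O, ‖Ec z‖ ≤ E₀ * Real.exp (-(κ * torusTreeLen Y.1))) ∧
        (∀ t ∈ Ioc (0 : ℝ) γ, Ec t = termC S j Y (Function.update g i t) ψ) := by
  have hM : 0 ≤ Real.exp 1 * 9 * 64 * K₀ 64 8 ^ 2 * (c.C3act * c.ε₁) := by positivity
  have hE₀ : 0 ≤ E₀ := le_trans hM hrenew
  -- node N09's conditional data: one domain per (history, step)
  choose U hU using hlastOn
  obtain ⟨D, hDg⟩ : ∃ D : (ℕ → ℝ) → ℕ → Set ℂ, ∀ (g : ℕ → ℝ) (hg : g ∈ Window γ) (i : ℕ), D g i = U g hg i :=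
    ⟨fun g i => if hg : g ∈ Window γ then U g hg i else Set.univ, fun g hg i => dif_pos hg⟩
  have hDopen : ∀ (g : ℕ → ℝ), g ∈ Window γ → ∀ i : ℕ, IsOpen (D g i) := fun g hg i => by
    rw [hDg g hg i]
    exact (hU g hg i).1
  have hDdisc : ∀ (g : ℕ → ℝ), g ∈ Window γ → ∀ (i : ℕ), ∀ t ∈ Ioc (0 : ℝ) γ, closedBall (t : ℂ) r ⊆ D g i := fun g hg i t ht => by
    rw [hDg g hg i]
    exact (hU g hg i).2.1 t ht
  have hD : ∀ g ∈ Window γ, ∀ (i : ℕ), ∀ t ∈ Ioc (0 : ℝ) γ, ((t : ℝ) : ℂ) ∈ D g i := fun g hg i t ht =>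
    hDdisc g hg i t ht (mem_closedBall_self hr)
  have hall := stripBoundOn_termC_of_stepOutOn S (fun j Y => spaceI Sg Rz M j (domSites (F.P K) M j Y) cs.α₀ cs.α₁) D hE₀ hD (by
    intro k g hg i hi X φ hφ hprem
    rcases Nat.lt_succ_iff_lt_or_eq.mp hi with hik | hik
    · -- an OLDER coupling: the level-T hypothesis at the domain `D g i`, then 14′ §2
      obtain ⟨Hc, Tt, hhol, hdom, h226, hrepH⟩ := h226TOnOlder (D g i) (hDopen g hg i) (hDdisc g hg i) k g hg i hik X φ hφ hprem
      exact stripOn_succ_of_termwise226 F K S c hL hLc hN hA0 hr₁ hκ hrate hsmall hrenew k g i X φ Hc Tt (D g i) (hDopen g hg i) hhol hdom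
        h226 hrepH
    · -- the LAST coupling: print's conditional clause, its premise read off the inductive premise at the window point `g_i ∈ D g i`
      subst hik
      have hreal : ∀ (j : ℕ), j < i + 1 → ∀ (Y : (domSys (F.P K) M j).Dom) (ψ : CPair (F.P K) 𝔸),
          ψ ∈ spaceI Sg Rz M j (domSites (F.P K) M j Y) cs.α₀ cs.α₁ → ‖termC S j Y g ψ‖ ≤ E₀ * Real.exp (-(κ * torusTreeLen Y.1)) := by
        intro j hj Y ψ hψ
        obtain ⟨Ec, -, hbd, htr⟩ := hprem j hj Y ψ hψ
        have h := hbd _ (hD g hg i (g i) (hg i))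
        rwa [htr (g i) (hg i), Function.update_eq_self] at h
      rw [hDg g hg i]
      exact (hU g hg i).2.2 hreal X φ hφ)
  intro j g hg i Y ψ hψ
  obtain ⟨Ec, hhol, hbd, htr⟩ := hall j g hg i Y ψ hψ
  exact ⟨Ec, D g i, hDopen g hg i, hDdisc g hg i, hhol, hbd, htr⟩

end Producer

/-! ## §2 The conditional last-coupling clause under truncation, and on generated towers from the per-step schema (S-last) -/

section Faces

variable {F : T4Family} (k : ℕ) {𝔸 : Type*} [NormedRing 𝔸] [NormedAlgebra ℂ 𝔸] [CompleteSpace 𝔸] {G : Type*} [GaugeGroup G] {M : ℕ}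
  (Sg : Setting 𝔸 G) (Rz : Residual (F.P k) 𝔸)

open Classical in
/-- **THE CONDITIONAL LAST-COUPLING CLAUSE SURVIVES RUN-LENGTH TRUNCATION AND NEEDS THE UNTRUNCATED TOWER ONLY BELOW THE RUN LENGTH**: for `truncRun K T` at every step
⇐ the same for `T` at the steps `k′ < K` (below the run: `termC_truncRun_of_le` on both sides; beyond it the new term is `0`: `U := ℂ`, `Ec := 0`).
[cite: Balaban1987RG1, (0.23)-(0.24) pp.256-257 and §1 p.263] -/
theorem lastOn_truncRun (T : ClusterTower (F.P k) 𝔸 M) (K : ℕ) {cs : SFConsts} {γ r E₀ κ : ℝ} (hE₀ : 0 ≤ E₀)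
    (hbelow : ∀ (g : ℕ → ℝ), g ∈ Window γ → ∀ (k' : ℕ), k' < K → ∃ U : Set ℂ, IsOpen U ∧ (∀ t ∈ Ioc (0 : ℝ) γ, closedBall (t : ℂ) r ⊆ U) ∧
      ((∀ (j : ℕ), j < k' + 1 → ∀ (Y : (domSys (F.P k) M j).Dom) (ψ : CPair (F.P k) 𝔸), ψ ∈ spaceI Sg Rz M j (domSites (F.P k) M j Y) cs.α₀ cs.α₁ →
          ‖termC T j Y g ψ‖ ≤ E₀ * Real.exp (-(κ * torusTreeLen Y.1))) →
        ∀ (X : (domSys (F.P k) M (k' + 1)).Dom) (φ : CPair (F.P k) 𝔸), φ ∈ spaceI Sg Rz M (k' + 1) (domSites (F.P k) M (k' + 1) X) cs.α₀ cs.α₁ →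
          ∃ Ec : ℂ → ℂ, DifferentiableOn ℂ Ec U ∧ (∀ z ∈ U, ‖Ec z‖ ≤ E₀ * Real.exp (-(κ * torusTreeLen X.1))) ∧
            (∀ t ∈ Ioc (0 : ℝ) γ, Ec t = termC T (k' + 1) X (Function.update g k' t) φ))) :
    ∀ (g : ℕ → ℝ), g ∈ Window γ → ∀ (k' : ℕ), ∃ U : Set ℂ, IsOpen U ∧ (∀ t ∈ Ioc (0 : ℝ) γ, closedBall (t : ℂ) r ⊆ U) ∧
      ((∀ (j : ℕ), j < k' + 1 → ∀ (Y : (domSys (F.P k) M j).Dom) (ψ : CPair (F.P k) 𝔸), ψ ∈ spaceI Sg Rz M j (domSites (F.P k) M j Y) cs.α₀ cs.α₁ →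
          ‖termC (truncRun K T) j Y g ψ‖ ≤ E₀ * Real.exp (-(κ * torusTreeLen Y.1))) →
        ∀ (X : (domSys (F.P k) M (k' + 1)).Dom) (φ : CPair (F.P k) 𝔸), φ ∈ spaceI Sg Rz M (k' + 1) (domSites (F.P k) M (k' + 1) X) cs.α₀ cs.α₁ →
          ∃ Ec : ℂ → ℂ, DifferentiableOn ℂ Ec U ∧ (∀ z ∈ U, ‖Ec z‖ ≤ E₀ * Real.exp (-(κ * torusTreeLen X.1))) ∧
            (∀ t ∈ Ioc (0 : ℝ) γ, Ec t = termC (truncRun K T) (k' + 1) X (Function.update g k' t) φ)) := by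
  intro g hg k'
  rcases Nat.lt_or_ge k' K with hk | hk
  · obtain ⟨U, hU, hdisc, hcond⟩ := hbelow g hg k' hk
    refine ⟨U, hU, hdisc, fun hreal X φ hφ => ?_⟩
    obtain ⟨Ec, hhol, hbd, htr⟩ := hcond (fun j hj Y ψ hψ => by
      rw [← termC_truncRun_of_le T ((Nat.lt_succ_iff.mp hj).trans hk.le) Y g ψ]
      exact hreal j hj Y ψ hψ) X φ hφ
    exact ⟨Ec, hhol, hbd, fun t ht => (htr t ht).trans (termC_truncRun_of_le T hk X _ φ).symm⟩
  · refine ⟨Set.univ, isOpen_univ, fun _ _ => Set.subset_univ _, fun _ X φ _ => ⟨fun _ => 0, differentiableOn_const 0, fun z _ => ?_, fun t _ => ?_⟩⟩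
    · rw [norm_zero]; positivity
    · exact (termC_truncRun_eq_zero T (Nat.lt_succ_of_le hk) X _ φ).symm

open Classical in
/-- **THE CONDITIONAL LAST-COUPLING CLAUSE ON A GENERATED TOWER FROM THE PER-STEP SCHEMA (S-last)** at the steps `k′ < K`: (S-last)_{k′} — for every older-terms family
`old` there is an open `U ⊇` the closed `r`-discs about `]0, γ]` such that IF `old` is (1.18)-bounded on the space tables THEN for every `X ∈ 𝐃_{k′+1}`, `φ ∈ U^c_{k′+1}(X)`,
`t ↦ (Gn k′).E t old φ X` is holomorphic on `U` with `‖·‖ ≤ E₀e^{−κ d_{k′+1}(X)}` there ([I] p. 263 ∕ [B12] Thm 3 read for the one-step map) ⟹ §1's `hlastOn` body for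
`toClusterTower Gn` at the steps `k′ < K` (the older terms at `g|g_{k′} := t` are those at `g`: `recTerm_congr_prefix`; the new term is the one-step map at `↑t`:
`termC_toClusterTower`, `recTerm_succ`). [cite: Balaban1987RG1, §1 p.263 and (2.12)-(2.13) p.268; Balaban1988RG2Cluster, (2.13)-(2.14) pp.14-15] -/
theorem lastOn_toClusterTower_of_stepSchemaLast (Gn : GenTower (F.P k) 𝔸 M) (K : ℕ) {cs : SFConsts} {γ r E₀ κ : ℝ}
    (hlastG : ∀ (k' : ℕ), k' < K → ∀ (old : OlderTerms (F.P k) 𝔸 M k'), ∃ U : Set ℂ, IsOpen U ∧ (∀ t ∈ Ioc (0 : ℝ) γ, closedBall (t : ℂ) r ⊆ U) ∧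
      ((∀ (j : Fin (k' + 1)) (Y : (domSys (F.P k) M j).Dom) (ψ : CPair (F.P k) 𝔸), ψ ∈ spaceI Sg Rz M j (domSites (F.P k) M j Y) cs.α₀ cs.α₁ →
          ‖old j Y ψ‖ ≤ E₀ * Real.exp (-(κ * torusTreeLen Y.1))) →
        ∀ (X : (domSys (F.P k) M (k' + 1)).Dom) (φ : CPair (F.P k) 𝔸), φ ∈ spaceI Sg Rz M (k' + 1) (domSites (F.P k) M (k' + 1) X) cs.α₀ cs.α₁ →
          DifferentiableOn ℂ (fun z => (Gn k').E z old φ X) U ∧ ∀ z ∈ U, ‖(Gn k').E z old φ X‖ ≤ E₀ * Real.exp (-(κ * torusTreeLen X.1)))) :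
    ∀ (g : ℕ → ℝ), g ∈ Window γ → ∀ (k' : ℕ), k' < K → ∃ U : Set ℂ, IsOpen U ∧ (∀ t ∈ Ioc (0 : ℝ) γ, closedBall (t : ℂ) r ⊆ U) ∧
      ((∀ (j : ℕ), j < k' + 1 → ∀ (Y : (domSys (F.P k) M j).Dom) (ψ : CPair (F.P k) 𝔸), ψ ∈ spaceI Sg Rz M j (domSites (F.P k) M j Y) cs.α₀ cs.α₁ →
          ‖termC (toClusterTower Gn) j Y g ψ‖ ≤ E₀ * Real.exp (-(κ * torusTreeLen Y.1))) →
        ∀ (X : (domSys (F.P k) M (k' + 1)).Dom) (φ : CPair (F.P k) 𝔸), φ ∈ spaceI Sg Rz M (k' + 1) (domSites (F.P k) M (k' + 1) X) cs.α₀ cs.α₁ →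
          ∃ Ec : ℂ → ℂ, DifferentiableOn ℂ Ec U ∧ (∀ z ∈ U, ‖Ec z‖ ≤ E₀ * Real.exp (-(κ * torusTreeLen X.1))) ∧
            (∀ t ∈ Ioc (0 : ℝ) γ, Ec t = termC (toClusterTower Gn) (k' + 1) X (Function.update g k' t) φ)) := by
  intro g _ k' hk
  obtain ⟨U, hU, hdisc, hcond⟩ := hlastG k' hk (olderOf (recTerm Gn fun n => ((g n : ℝ) : ℂ)) k')
  refine ⟨U, hU, hdisc, fun hreal X φ hφ => ?_⟩
  obtain ⟨hhol, hbd⟩ := hcond (fun j Y ψ hψ => by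
    rw [olderOf_apply, ← termC_toClusterTower]
    exact hreal j.1 j.2 Y ψ hψ) X φ hφ
  refine ⟨fun z => (Gn k').E z (olderOf (recTerm Gn fun n => ((g n : ℝ) : ℂ)) k') φ X, hhol, hbd, fun t _ => ?_⟩
  -- the new term at `g|g_{k'} := t` is the one-step map at `↑t` and the older terms generated at `g`
  rw [termC_toClusterTower, recTerm_succ]
  beta_reduce
  rw [Function.update_self]
  refine congrArg (fun old => (Gn k').E ((t : ℝ) : ℂ) old φ X) ?_
  funext j Y ψ
  rw [olderOf_apply, olderOf_apply]
  exact recTerm_congr_prefix Gn j.1 (fun n hn => by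
    show ((g n : ℝ) : ℂ) = ((Function.update g k' t n : ℝ) : ℂ)
    rw [Function.update_of_ne (Nat.ne_of_lt (lt_of_lt_of_le hn (Nat.le_of_lt_succ j.2)))]) Y ψ

end Faces

/-! ## §3 Non-vacuity (A5 riders) -/

section Riders

variable {F : T4Family} (k : ℕ) {𝔸 : Type*} [NormedRing 𝔸] [NormedAlgebra ℂ 𝔸] [CompleteSpace 𝔸] {G : Type*} [GaugeGroup G] {M : ℕ}
  (Sg : Setting 𝔸 G) (Rz : Residual (F.P k) 𝔸)

/-- **NON-VACUITY OF `hlastOn` (A5 rider)**: the termless model tower carries it at every step with `U := ℂ`, `Ec := 0` (`0 ≤ E₀`).  Model tower, NOT NODE 00's.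
[folklore] -/
theorem lastOn_termlessTower {cs : SFConsts} {γ r E₀ κ : ℝ} (hE₀ : 0 ≤ E₀) :
    ∀ (g : ℕ → ℝ), g ∈ Window γ → ∀ (k' : ℕ), ∃ U : Set ℂ, IsOpen U ∧ (∀ t ∈ Ioc (0 : ℝ) γ, closedBall (t : ℂ) r ⊆ U) ∧
      ((∀ (j : ℕ), j < k' + 1 → ∀ (Y : (domSys (F.P k) M j).Dom) (ψ : CPair (F.P k) 𝔸), ψ ∈ spaceI Sg Rz M j (domSites (F.P k) M j Y) cs.α₀ cs.α₁ →
          ‖termC (termlessTower (F.P k) 𝔸 M) j Y g ψ‖ ≤ E₀ * Real.exp (-(κ * torusTreeLen Y.1))) →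
        ∀ (X : (domSys (F.P k) M (k' + 1)).Dom) (φ : CPair (F.P k) 𝔸), φ ∈ spaceI Sg Rz M (k' + 1) (domSites (F.P k) M (k' + 1) X) cs.α₀ cs.α₁ →
          ∃ Ec : ℂ → ℂ, DifferentiableOn ℂ Ec U ∧ (∀ z ∈ U, ‖Ec z‖ ≤ E₀ * Real.exp (-(κ * torusTreeLen X.1))) ∧
            (∀ t ∈ Ioc (0 : ℝ) γ, Ec t = termC (termlessTower (F.P k) 𝔸 M) (k' + 1) X (Function.update g k' t) φ)) :=
  fun _ _ k' => ⟨Set.univ, isOpen_univ, fun _ _ => Set.subset_univ _, fun _ X φ _ =>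
    ⟨fun _ => 0, differentiableOn_const 0, fun z _ => by rw [norm_zero]; positivity, fun t _ => (termC_termlessTower (k' + 1) X _ φ).symm⟩⟩

omit [NormedRing 𝔸] [NormedAlgebra ℂ 𝔸] [CompleteSpace 𝔸] in
open Classical in
/-- The one-step map of the termless generator (`idx Z = ∅`) vanishes: the Kotecký–Preiss sum of the zero activity, read off g2's `E_termlessTower` through
`B13Resummation.locE_congr` (one `locE` literal on both sides). [cite: Balaban1988RG2Cluster, (2.13) p.14 (bookkeeping; the empty instance)] -/
theorem stepGenE_termlessGen (k' : ℕ) (t : ℂ) (old : OlderTerms (F.P k) 𝔸 M k') (φ : CPair (F.P k) 𝔸) (X : (domSys (F.P k) M (k' + 1)).Dom) :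
    ((fun k' => (⟨PUnit, fun _ => ∅, fun _ _ _ _ => 0⟩ : StepGen (F.P k) 𝔸 M k')) k').E t old φ X = 0 := by
  have h1 : ((fun k' => (⟨PUnit, fun _ => ∅, fun _ _ _ _ => 0⟩ : StepGen (F.P k) 𝔸 M k')) k').E t old φ X =
      (termlessTower (F.P k) 𝔸 M k').E (fun _ => 0) φ X := by
    rw [ClusterStep.E_eq_locE]
    exact B13Resummation.locE_congr _ fun Z _ => by rw [H_termlessTower]; exact Finset.sum_empty
  rw [h1]
  exact E_termlessTower k' _ φ X

open Classical in
/-- **NON-VACUITY OF (S-last) (A5 rider)**: the termless generator tower (`idx Z = ∅`; one-step map `0` by `stepGenE_termlessGen`) carries (S-last) at every step with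
`U := ℂ`.  Model generator, NOT NODE 00's. [folklore] -/
theorem stepSchemaLast_termlessGen {cs : SFConsts} {γ r E₀ κ : ℝ} (hE₀ : 0 ≤ E₀) (K : ℕ) :
    ∀ (k' : ℕ), k' < K → ∀ (old : OlderTerms (F.P k) 𝔸 M k'), ∃ U : Set ℂ, IsOpen U ∧ (∀ t ∈ Ioc (0 : ℝ) γ, closedBall (t : ℂ) r ⊆ U) ∧
      ((∀ (j : Fin (k' + 1)) (Y : (domSys (F.P k) M j).Dom) (ψ : CPair (F.P k) 𝔸), ψ ∈ spaceI Sg Rz M j (domSites (F.P k) M j Y) cs.α₀ cs.α₁ →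
          ‖old j Y ψ‖ ≤ E₀ * Real.exp (-(κ * torusTreeLen Y.1))) →
        ∀ (X : (domSys (F.P k) M (k' + 1)).Dom) (φ : CPair (F.P k) 𝔸), φ ∈ spaceI Sg Rz M (k' + 1) (domSites (F.P k) M (k' + 1) X) cs.α₀ cs.α₁ →
          DifferentiableOn ℂ (fun z => ((fun k' => (⟨PUnit, fun _ => ∅, fun _ _ _ _ => 0⟩ : StepGen (F.P k) 𝔸 M k')) k').E z old φ X) U ∧
            ∀ z ∈ U, ‖((fun k' => (⟨PUnit, fun _ => ∅, fun _ _ _ _ => 0⟩ : StepGen (F.P k) 𝔸 M k')) k').E z old φ X‖ ≤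
              E₀ * Real.exp (-(κ * torusTreeLen X.1))) := by
  intro k' _ old
  refine ⟨Set.univ, isOpen_univ, fun _ _ => Set.subset_univ _, fun _ X φ _ => ⟨?_, fun z _ => ?_⟩⟩
  · have h : (fun z : ℂ => ((fun k' => (⟨PUnit, fun _ => ∅, fun _ _ _ _ => 0⟩ : StepGen (F.P k) 𝔸 M k')) k').E z old φ X) = fun _ => 0 :=
      funext fun z => stepGenE_termlessGen k k' z old φ X
    rw [h]
    exact differentiableOn_const 0
  · rw [stepGenE_termlessGen k k' z old φ X, norm_zero]; positivity

end Riders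

end YMDAG.N22.W1

end
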